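import Summits.CriticalPhenomena.CardyFormulaZ2.Theorems.CardyAnchoredRigiditySubseqCardySquareCardy

/-!
# Self-duality of every joint sequential limit on rectangles
# (crux `SubseqCardy`, stmt-CriticalPhenomena-5768, line `registered`: structure of joint limits, part 7)

Route `CardyAnchoredRigidity` (decl shared with `CardyLocalRigidity`), sub-problem `CardyFormulaZ2`.
For every joint sequential limit `g` of the bond-`ℤ²` crossing probabilities (the objects of S2/S3)
and every axis-parallel box `(0,w) × (0,1)`:

  `g (box crossed left-to-right) + g (box crossed bottom-to-top) = 1`

(`JointLimit.lr_add_bt_eq_one`, registered sub-goal `jointLimit_rectSelfDual`). This is the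
continuum shadow of planar duality at `p = 1/2`, for EVERY sublimit and without any conformal
invariance — the "self-dual" input that the polarization / rotation-to-conformal upgrades of S2
(route `CardyMirrorMonotone`, stub `stub_ppiSublimitUpgrade`) take for granted.

Proof (lattice bookkeeping at FITTED meshes + the structure theory, no new estimate). At a fitted
mesh `1/m` (`(a+1) < w m ≤ a+2`): the left-to-right value is EXACTLY `h(a, m-2)` (`bond_lr_eq`), the
bottom-to-top value lies in `[h(m-2, a-1), h(m-2, a)]` (`le_bond_bt`, `bond_bt_le`), `h = crossingProb
half`. Planar duality `h(M+1, N) + h(N+1, M) = 1` (`crossingProb_add_crossingProb_symm_holds`) and width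
monotonicity give AT ONCE `LR + BT ≥ 1` at every fitted mesh (`one_le_lr_add_bt`), hence in the limit
(fitted meshes carry the joint limit, `tendsto_fitted`). Conversely `BT(w) ≤ 1 - h(a+1, m-3)` and, for
`w'' > w` and `m` large, `h(a+1, m-3) ≥ LR(w'')` at the fitted mesh `1/(m-1)` (`bt_add_lr_le_one`); the
meshes `1/(m-1)` still carry the joint limit (`tendsto_fitted_pred`, scale continuity), so
`BT(w) + LR(w'') ≤ 1` for every `w'' > w`, and `w'' ↓ w` by the Schramm–Smirnov continuity of `g`
under the stretch `x ↦ (w''/w) x` (`JointLimit.abs_sub_map_le`).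

References: B. Bollobás, O. Riordan, *Percolation* (2006), Ch. 3 Lemma 1; G. Grimmett, *Percolation*
(1999) §11.2; O. Schramm, S. Smirnov, Ann. Probab. 39 (2011) §5.
-/

noncomputable section

namespace Summit.CriticalPhenomena.CardyFormulaZ2.Cruxes.SubseqCardy.Birth

open Set Filter Topology Metric MeasureTheory Complex
open Literature.Probability.RandomPlanarGeometry (ConformalRectangle MarkedDomain)
open Literature.Probability.LatticeModels
open Literature.Probability.Percolation (bondDomainCrossingProb crossingProb half rectQuad rectQuad_carrier
  mem_rectQuad_arc_zero mem_rectQuad_arc_two crossingProb_anti_left crossingProb_mono_right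
  crossingProb_half_succ_self_holds crossingProb_add_crossingProb_symm_holds symm_half)
open Summit.CriticalPhenomena.CardyFormulaZ2.Theorems.ClusterSetConnected (scaleContinuity)
open Summit.CriticalPhenomena.CardyFormulaZ2.Cruxes.SimilarityUpgrade.Stubs.RectangleDuality (bond_lr_eq bond_bt_le
  le_bond_bt real_shift_tbCrossing)

namespace JointLimit

variable {u : ℕ → ℝ} {g : ConformalRectangle → ℝ}

/-! ### The box `(0,w) × (0,1)` crossed from left to right -/

/-- The reflection `x + iy ↦ y + ix` as a plane homeomorphism (conjugation, then the quarter turn).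
[folklore] -/
theorem exists_swapHomeo : ∃ P : ℂ ≃ₜ ℂ, ∀ z, (P z).re = z.im ∧ (P z).im = z.re :=
  ⟨Complex.conjCLE.toHomeomorph.trans (Homeomorph.mulLeft₀ I I_ne_zero), fun z => by
    simp [Homeomorph.trans_apply]⟩

/-- **A box `(0,w) × (0,1)` marked for the left-to-right crossing**: some conformal rectangle has
this carrier, arc `0` = left side, arc `2` = right side (the reflection in the diagonal of the
bottom-to-top box `(0,1) × (0,w)`). [folklore] -/
theorem exists_lrBox (w : ℝ) (hw : 0 < w) : ∃ L : ConformalRectangle,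
    L.carrier = (Ioo (0:ℝ) w ×ℂ Ioo (0:ℝ) 1) ∧ L.arc 0 = {z : ℂ | z.re = 0 ∧ z.im ∈ Icc (0:ℝ) 1} ∧
      L.arc 2 = {z : ℂ | z.re = w ∧ z.im ∈ Icc (0:ℝ) 1} := by
  obtain ⟨P, hP⟩ := exists_swapHomeo
  have hF : ∀ z, (P z).re = id z.im ∧ (P z).im = id z.re := hP
  refine ⟨(rectQuad 0 1 0 w one_pos hw).map P, ?_, ?_, ?_⟩
  · rw [MarkedDomain.carrier_map, rectQuad_carrier, image_reProdIm_of_im_re hF, image_id, image_id]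
  · rw [MarkedDomain.arc_map, show (rectQuad 0 1 0 w one_pos hw).arc 0 = {z : ℂ | z.im = 0 ∧ z.re ∈ Icc (0:ℝ) 1} from
      Set.ext fun z => mem_rectQuad_arc_zero one_pos hw, setOf_im_eq_re_mem, image_reProdIm_of_im_re hF,
      image_id, image_id, setOf_re_eq_im_mem]
  · rw [MarkedDomain.arc_map, show (rectQuad 0 1 0 w one_pos hw).arc 2 = {z : ℂ | z.im = w ∧ z.re ∈ Icc (0:ℝ) 1} from
      Set.ext fun z => mem_rectQuad_arc_two one_pos hw, setOf_im_eq_re_mem, image_reProdIm_of_im_re hF,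
      image_id, image_id, setOf_re_eq_im_mem]

/-! ### Lattice bookkeeping at fitted meshes -/

/-- The width window at mesh `1/m`: `(a+1)/m < w ≤ (a+2)/m`. [folklore] -/
theorem exists_window_div {w : ℝ} {m : ℕ} (hm : (0:ℝ) < m) (hx : 1 < w * m) :
    ∃ a : ℕ, 1 / (m:ℝ) * (a + 1) < w ∧ w ≤ 1 / (m:ℝ) * (a + 2) ∧ (a:ℝ) + 1 < w * m ∧ w * m ≤ a + 2 := by
  obtain ⟨a, ha1, ha2⟩ := exists_window hx
  refine ⟨a, ?_, ?_, ha1, ha2⟩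
  · rw [div_mul_eq_mul_div, one_mul, div_lt_iff₀ hm]; exact ha1
  · rw [div_mul_eq_mul_div, one_mul, le_div_iff₀ hm]; exact ha2

/-- The height fits at mesh `1/m`: `(1/m) ((m-2) + 2) = 1`. [folklore] -/
theorem fit_height {m : ℕ} (hm : 2 ≤ m) : 1 / (m:ℝ) * (((m - 2 : ℕ) : ℝ) + 2) = 1 := by
  have hm0 : (0:ℝ) < m := by exact_mod_cast (by omega : 0 < m)
  rw [Nat.cast_sub hm]; push_cast; field_simp; ring

/-- **`LR + BT ≥ 1` at every fitted mesh.** For the box `(0,w) × (0,1)` at mesh `1/m` (`m ≥ 3`,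
`w m > 2`): `LR = h(a, m-2)` and `BT ≥ h(m-2, a-1)`, while duality gives
`h(a, m-2) = 1 - h(m-1, a-1) ≥ 1 - h(m-2, a-1)`. [cite: BollobasRiordan2006, Ch. 3 Lemma 1] -/
theorem one_le_lr_add_bt {w : ℝ} (hw : 0 < w) (L : ConformalRectangle)
    (hLc : L.carrier = (Ioo (0:ℝ) w ×ℂ Ioo (0:ℝ) 1)) (hL0 : L.arc 0 = {z : ℂ | z.re = 0 ∧ z.im ∈ Icc (0:ℝ) 1})
    (hL2 : L.arc 2 = {z : ℂ | z.re = w ∧ z.im ∈ Icc (0:ℝ) 1}) {m : ℕ} (hm : 3 ≤ m) (hwm : 2 < w * m) :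
    1 ≤ bondDomainCrossingProb L (1 / m) + bondDomainCrossingProb (rectQuad 0 w 0 1 hw one_pos) (1 / m) := by
  have hm0 : (0:ℝ) < m := by exact_mod_cast (by omega : 0 < m)
  have hδ : (0:ℝ) < 1 / m := by positivity
  obtain ⟨a, ha, ha', ha1, ha2⟩ := exists_window_div (w := w) hm0 (by linarith)
  have hb := fit_height (by omega : 2 ≤ m)
  have h1a : 1 ≤ a := by
    have : (2:ℝ) < a + 2 := hwm.trans_le ha2
    have : (0:ℝ) < a := by linarith
    exact_mod_cast Nat.one_le_iff_ne_zero.2 (by rintro rfl; simp at this)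
  have hLR := bond_lr_eq L hLc hL0 hL2 hδ ha ha' hb h1a
  have hBT := le_bond_bt (rectQuad 0 w 0 1 hw one_pos) (btBox_carrier _) (btBox_arc_zero _) (btBox_arc_two _) hδ ha ha' hb
    (a' := a - 1) (by omega)
  rw [real_shift_tbCrossing] at hBT
  -- duality: `h(a, m-2) + h(m-1, a-1) = 1`
  have hdual := crossingProb_add_crossingProb_symm_holds half (a - 1) (m - 2)
  rw [symm_half, Nat.sub_add_cancel h1a, show m - 2 + 1 = m - 1 by omega] at hdual
  -- width monotonicity: `h(m-1, a-1) ≤ h(m-2, a-1)`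
  have hmono : crossingProb half (m - 1) (a - 1) ≤ crossingProb half (m - 2) (a - 1) :=
    crossingProb_anti_left half (by omega) (a - 1)
  rw [hLR]
  linarith

/-- **`BT(w) + LR(w'') ≤ 1` across two consecutive fitted meshes**, for `w'' > w` and `m` large
(`m (w'' - w) ≥ w'' + 2`): at mesh `1/m`, `BT(w) ≤ h(m-2, a) = 1 - h(a+1, m-3)`; at mesh `1/(m-1)`,
`LR(w'') = h(a'', m-3)` with `a'' ≥ a + 1`, so `LR(w'') ≤ h(a+1, m-3)`.
[cite: BollobasRiordan2006, Ch. 3 Lemma 1] -/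
theorem bt_add_lr_le_one {w w'' : ℝ} (hw : 0 < w) (hww : w < w'') (L : ConformalRectangle)
    (hLc : L.carrier = (Ioo (0:ℝ) w'' ×ℂ Ioo (0:ℝ) 1)) (hL0 : L.arc 0 = {z : ℂ | z.re = 0 ∧ z.im ∈ Icc (0:ℝ) 1})
    (hL2 : L.arc 2 = {z : ℂ | z.re = w'' ∧ z.im ∈ Icc (0:ℝ) 1}) {m : ℕ} (hm : 4 ≤ m) (hwm : 2 < w * m)
    (hbig : w'' + 2 ≤ m * (w'' - w)) :
    bondDomainCrossingProb (rectQuad 0 w 0 1 hw one_pos) (1 / m) + bondDomainCrossingProb L (1 / ((m:ℝ) - 1)) ≤ 1 := by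
  have hm0 : (0:ℝ) < m := by exact_mod_cast (by omega : 0 < m)
  have hm1 : (0:ℝ) < (m:ℝ) - 1 := by
    have : (4:ℝ) ≤ m := by exact_mod_cast hm
    linarith
  have hcast : ((m - 1 : ℕ) : ℝ) = (m:ℝ) - 1 := by rw [Nat.cast_sub (by omega)]; push_cast; ring
  have hδ : (0:ℝ) < 1 / m := by positivity
  have hδ' : (0:ℝ) < 1 / ((m:ℝ) - 1) := by positivity
  -- the BT box at mesh `1/m`
  obtain ⟨a, ha, ha', ha1, ha2⟩ := exists_window_div (w := w) hm0 (by linarith)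
  have hb := fit_height (by omega : 2 ≤ m)
  have hBT := bond_bt_le (rectQuad 0 w 0 1 hw one_pos) (btBox_carrier _) (btBox_arc_zero _) (btBox_arc_two _) hδ ha ha' hb
  rw [real_shift_tbCrossing] at hBT
  -- duality at `(M, N) = (a, m-3)`: `h(a+1, m-3) + h(m-2, a) = 1`
  have hdual := crossingProb_add_crossingProb_symm_holds half a (m - 3)
  rw [symm_half, show m - 3 + 1 = m - 2 by omega] at hdual
  -- the LR box at mesh `1/(m-1)`
  have hw'' : 0 < w'' := hw.trans hww
  have hx'' : 1 < w'' * ((m:ℝ) - 1) := by nlinarith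
  obtain ⟨a'', ha''1, ha''2⟩ := exists_window hx''
  have ha''lt : 1 / ((m:ℝ) - 1) * (a'' + 1) < w'' := by
    rw [div_mul_eq_mul_div, one_mul, div_lt_iff₀ hm1]; exact ha''1
  have ha''le : w'' ≤ 1 / ((m:ℝ) - 1) * (a'' + 2) := by
    rw [div_mul_eq_mul_div, one_mul, le_div_iff₀ hm1]; exact ha''2
  have hb'' : 1 / ((m:ℝ) - 1) * (((m - 3 : ℕ) : ℝ) + 2) = 1 := by
    rw [Nat.cast_sub (by omega : 3 ≤ m)]; push_cast; field_simp; ring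
  -- `a'' ≥ a + 1 ≥ 1`
  have haa : a + 1 ≤ a'' := by
    have h1 : (a:ℝ) + 1 < w * m := ha1
    have h2 : w'' * ((m:ℝ) - 1) ≤ a'' + 2 := ha''2
    have h3 : w * m + 2 ≤ w'' * ((m:ℝ) - 1) := by nlinarith
    have h4 : (a:ℝ) + 1 < a'' := by linarith
    exact_mod_cast h4.le
  have h1a'' : 1 ≤ a'' := by omega
  have hLR := bond_lr_eq L hLc hL0 hL2 hδ' ha''lt ha''le hb'' h1a''
  have hmono : crossingProb half a'' (m - 3) ≤ crossingProb half (a + 1) (m - 3) :=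
    crossingProb_anti_left half haa (m - 3)
  rw [hLR]
  linarith

/-! ### The meshes `1/(m-1)` still carry the joint limit -/

/-- Along `1/(⌊1/u n⌋₊ - 1)` every coordinate has the same limit as along `u` (scale continuity
between the consecutive fitted meshes `1/m` and `1/(m-1)`, then `tendsto_fitted`). [folklore] -/
theorem tendsto_fitted_pred (hu : Tendsto u atTop (𝓝[>] (0 : ℝ)))
    (hg : ∀ R : ConformalRectangle, Tendsto (fun n => bondDomainCrossingProb R (u n)) atTop (𝓝 (g R)))
    (R : ConformalRectangle) :
    Tendsto (fun n => bondDomainCrossingProb R (1 / ((⌊1 / u n⌋₊ : ℝ) - 1))) atTop (𝓝 (g R)) := by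
  have hu0 : Tendsto u atTop (𝓝 (0:ℝ)) := (tendsto_nhdsWithin_iff.1 hu).1
  have hupos : ∀ᶠ n in atTop, 0 < u n := (tendsto_nhdsWithin_iff.1 hu).2
  have hm : Tendsto (fun n => ⌊1 / u n⌋₊) atTop atTop := by
    refine tendsto_atTop.2 fun M => ?_
    have hsmall : ∀ᶠ n in atTop, u n < 1 / ((M:ℝ) + 1) := hu0.eventually (Iio_mem_nhds (by positivity))
    filter_upwards [hupos, hsmall] with n hn hns
    refine Nat.le_floor ?_
    have : (M:ℝ) + 1 ≤ 1 / u n := by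
      rw [le_div_iff₀ hn]
      have := (lt_div_iff₀ (by positivity : (0:ℝ) < M + 1)).1 hns
      linarith
    linarith
  have hdiff : Tendsto (fun n => bondDomainCrossingProb R (1 / ((⌊1 / u n⌋₊ : ℝ) - 1)) -
      bondDomainCrossingProb R (1 / (⌊1 / u n⌋₊ : ℝ))) atTop (𝓝 0) := by
    rw [Metric.tendsto_nhds]
    intro ε hε
    obtain ⟨θ, hθ, δ₀, hδ₀, H⟩ := scaleContinuity R ε hε
    obtain ⟨M, hM⟩ := exists_nat_one_div_lt (half_pos hδ₀)
    obtain ⟨N, hN⟩ := exists_nat_one_div_lt hθ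
    filter_upwards [hm.eventually_ge_atTop (max (M + 2) (N + 2))] with n hn
    set m : ℕ := ⌊1 / u n⌋₊ with hmdef
    have hmM : M + 2 ≤ m := (le_max_left _ _).trans hn
    have hmN : N + 2 ≤ m := (le_max_right _ _).trans hn
    have hm2 : (2:ℝ) ≤ m := by exact_mod_cast (by omega : 2 ≤ m)
    have hm0 : (0:ℝ) < m := by linarith
    have hm1 : (0:ℝ) < (m:ℝ) - 1 := by linarith
    -- `1/m ≤ 1/(m-1) ≤ (1+θ)/m`, both `< δ₀`
    have h1 : 1 / (m:ℝ) ≤ 1 / ((m:ℝ) - 1) := one_div_le_one_div_of_le hm1 (by linarith)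
    have h2 : 1 / ((m:ℝ) - 1) ≤ (1 + θ) * (1 / (m:ℝ)) := by
      rw [div_le_iff₀ hm1, mul_one_div, div_mul_eq_mul_div, le_div_iff₀ hm0]
      -- `m ≤ (1+θ)(m-1)` iff `1 + θ ≤ θ m`, true since `θ (N+1) > 1` and `m ≥ N + 2`
      have hN' : 1 < θ * ((N:ℝ) + 1) := by
        rw [one_div_lt (by positivity) hθ] at hN
        rw [← div_lt_iff₀' hθ] ; rw [one_div] at hN ⊢; simpa using hN
      have hmN' : (N:ℝ) + 2 ≤ m := by exact_mod_cast hmN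
      nlinarith
    have h3 : 1 / ((m:ℝ) - 1) < δ₀ := by
      have hmM' : (M:ℝ) + 1 ≤ (m:ℝ) - 1 := by
        have : ((M + 2 : ℕ) : ℝ) ≤ m := by exact_mod_cast hmM
        push_cast at this; linarith
      have := one_div_le_one_div_of_le (by positivity) hmM'
      linarith
    have key := H (1 / (m:ℝ)) (1 / ((m:ℝ) - 1)) (by positivity) h1 h3 h2
    rwa [Real.dist_eq, sub_zero]
  have := hdiff.add (tendsto_fitted hu hg R)
  simp only [zero_add, sub_add_cancel] at this
  exact this

/-! ### Self-duality -/

/-- **Every joint sequential limit is self-dual on the boxes `(0,w) × (0,1)`**: left-to-right value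
plus bottom-to-top value equals `1`. [folklore] -/
theorem lr_add_bt_eq_one (hu : Tendsto u atTop (𝓝[>] (0 : ℝ)))
    (hg : ∀ R : ConformalRectangle, Tendsto (fun n => bondDomainCrossingProb R (u n)) atTop (𝓝 (g R)))
    {w : ℝ} (hw : 0 < w) (L : ConformalRectangle)
    (hLc : L.carrier = (Ioo (0:ℝ) w ×ℂ Ioo (0:ℝ) 1)) (hL0 : L.arc 0 = {z : ℂ | z.re = 0 ∧ z.im ∈ Icc (0:ℝ) 1})
    (hL2 : L.arc 2 = {z : ℂ | z.re = w ∧ z.im ∈ Icc (0:ℝ) 1}) :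
    g L + g (rectQuad 0 w 0 1 hw one_pos) = 1 := by
  have hu0 : Tendsto u atTop (𝓝 (0:ℝ)) := (tendsto_nhdsWithin_iff.1 hu).1
  have hupos : ∀ᶠ n in atTop, 0 < u n := (tendsto_nhdsWithin_iff.1 hu).2
  have hm : Tendsto (fun n => ⌊1 / u n⌋₊) atTop atTop := by
    refine tendsto_atTop.2 fun M => ?_
    have hsmall : ∀ᶠ n in atTop, u n < 1 / ((M:ℝ) + 1) := hu0.eventually (Iio_mem_nhds (by positivity))
    filter_upwards [hupos, hsmall] with n hn hns
    refine Nat.le_floor ?_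
    have : (M:ℝ) + 1 ≤ 1 / u n := by
      rw [le_div_iff₀ hn]
      have := (lt_div_iff₀ (by positivity : (0:ℝ) < M + 1)).1 hns
      linarith
    linarith
  have hmR : Tendsto (fun n => ((⌊1 / u n⌋₊ : ℕ) : ℝ)) atTop atTop := tendsto_natCast_atTop_atTop.comp hm
  -- (≥): at every fitted mesh
  have hge : 1 ≤ g L + g (rectQuad 0 w 0 1 hw one_pos) := by
    refine ge_of_tendsto ((tendsto_fitted hu hg L).add (tendsto_fitted hu hg _)) ?_
    filter_upwards [hm.eventually_ge_atTop 3, hmR.eventually_gt_atTop (2 / w)] with n hn hn'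
    refine one_le_lr_add_bt hw L hLc hL0 hL2 hn ?_
    rwa [div_lt_iff₀ hw, mul_comm] at hn'
  -- (≤): `g BT(w) + g LR(w'') ≤ 1` for every `w'' > w`
  have hle : ∀ (w'' : ℝ) (hww : w < w'') (L'' : ConformalRectangle),
      L''.carrier = (Ioo (0:ℝ) w'' ×ℂ Ioo (0:ℝ) 1) → L''.arc 0 = {z : ℂ | z.re = 0 ∧ z.im ∈ Icc (0:ℝ) 1} →
      L''.arc 2 = {z : ℂ | z.re = w'' ∧ z.im ∈ Icc (0:ℝ) 1} →
      g (rectQuad 0 w 0 1 hw one_pos) + g L'' ≤ 1 := by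
    intro w'' hww L'' hc'' h0'' h2''
    refine le_of_tendsto ((tendsto_fitted hu hg _).add (tendsto_fitted_pred hu hg L'')) ?_
    have hpos : 0 < w'' - w := by linarith
    filter_upwards [hm.eventually_ge_atTop 4, hmR.eventually_gt_atTop (2 / w),
      hmR.eventually_ge_atTop ((w'' + 2) / (w'' - w))] with n hn hn' hn''
    refine bt_add_lr_le_one hw hww L'' hc'' h0'' h2'' hn ?_ ?_
    · rwa [div_lt_iff₀ hw, mul_comm] at hn'
    · rwa [div_le_iff₀ hpos] at hn''
  refine le_antisymm ?_ hge
  -- continuity of `w'' ↦ g LR(w'')` at `w` from the right, through the stretch `x ↦ (w''/w) x`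
  refine le_of_forall_pos_le_add fun ε hε => ?_
  obtain ⟨η, hη, hcont⟩ := abs_sub_map_le hu hg L hε
  -- the factor `c = 1 + t`, `t` small
  set t : ℝ := min (1 / 2) (η / (2 * (w + 2))) with htdef
  have ht0 : 0 < t := lt_min (by norm_num) (by positivity)
  have ht1 : t ≤ 1 / 2 := min_le_left _ _
  have htη : t * (w + 2) ≤ η / 2 := by
    have : t ≤ η / (2 * (w + 2)) := min_le_right _ _
    rw [le_div_iff₀ (by positivity)] at this; linarith
  set c : ℝ := 1 + t with hcdef
  have hc0 : 0 < c := by linarith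
  have hc1 : 1 < c := by linarith
  obtain ⟨A, hA⟩ := CountableApprox.exists_stretch c 1 hc0.ne' one_ne_zero
  have hAri : ∀ z, (A z).re = (fun x => c * x) z.re ∧ (A z).im = id z.im := fun z => by
    rw [(hA z).1, (hA z).2, one_mul]; exact ⟨rfl, rfl⟩
  -- `L.map A` is a left-to-right box of width `c w > w`
  have hcL : (L.map A).carrier = (Ioo (0:ℝ) (c * w) ×ℂ Ioo (0:ℝ) 1) := by
    rw [MarkedDomain.carrier_map, hLc, image_reProdIm_of_re_im hAri, image_mul_left_Ioo hc0, image_id, mul_zero]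
  have h0L : (L.map A).arc 0 = {z : ℂ | z.re = 0 ∧ z.im ∈ Icc (0:ℝ) 1} := by
    rw [MarkedDomain.arc_map, hL0, setOf_re_eq_im_mem, image_reProdIm_of_re_im hAri, image_id, image_singleton,
      mul_zero]
  have h2L : (L.map A).arc 2 = {z : ℂ | z.re = c * w ∧ z.im ∈ Icc (0:ℝ) 1} := by
    rw [MarkedDomain.arc_map, hL2, setOf_re_eq_im_mem, image_reProdIm_of_re_im hAri, image_id, image_singleton,
      setOf_re_eq_im_mem]
  have hww : w < c * w := by nlinarith
  -- the stretch moves the unit neighbourhood of `L` by at most `t (w + 2) ≤ η`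
  have hclose : ∀ z ∈ Metric.cthickening 1 (closure L.carrier), dist (A z) z ≤ η := by
    intro z hz
    have hzre : |z.re| ≤ w + 1 := by
      have hK : IsCompact (closure L.carrier) := by
        rw [hLc, Complex.closure_reProdIm, closure_Ioo hw.ne, closure_Ioo (zero_ne_one' ℝ)]
        exact isCompact_Icc.reProdIm isCompact_Icc
      rw [hK.cthickening_eq_biUnion_closedBall zero_le_one, mem_iUnion₂] at hz
      obtain ⟨y, hy, hzy⟩ := hz
      rw [hLc, Complex.closure_reProdIm, closure_Ioo hw.ne, closure_Ioo (zero_ne_one' ℝ), Complex.mem_reProdIm,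
        mem_Icc] at hy
      have hd : dist z y ≤ 1 := mem_closedBall.1 hzy
      have hre : |z.re - y.re| ≤ dist z y := by
        rw [dist_eq_norm]; exact Complex.abs_re_le_norm (z - y)
      have htri : |z.re| ≤ |z.re - y.re| + |y.re| := by
        calc |z.re| = |(z.re - y.re) + y.re| := by ring_nf
          _ ≤ |z.re - y.re| + |y.re| := abs_add_le _ _
      have hy1 : |y.re| ≤ w := abs_le.2 ⟨by linarith [hy.1.1], hy.1.2⟩
      linarith
    rw [dist_eq_norm]
    refine (Complex.norm_le_abs_re_add_abs_im _).trans ?_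
    rw [Complex.sub_re, Complex.sub_im, (hA z).1, (hA z).2, one_mul, sub_self, abs_zero, add_zero,
      show c * z.re - z.re = t * z.re by rw [hcdef]; ring, abs_mul, abs_of_pos ht0]
    have : t * |z.re| ≤ t * (w + 1) := by gcongr
    nlinarith
  have key := hcont A hclose
  have hsum := hle (c * w) hww (L.map A) hcL h0L h2L
  rw [abs_le] at key
  linarith [key.1, key.2]

end JointLimit

/-- **Registered sub-goal `jointLimit_rectSelfDual` (line `registered`, lead c3) — every joint sequential
limit of the bond-`ℤ²` crossing probabilities is self-dual on rectangles**: for every mesh sequence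
`u n → 0⁺`, every `g` with `bondDomainCrossingProb R (u n) → g R` for all `R`, every `w > 0` and every
conformal rectangle `L` with carrier `(0,w) × (0,1)`, arc `0` = left side, arc `2` = right side,
`g L + g (rectQuad 0 w 0 1) = 1` (the latter crossed bottom-to-top). [folklore] -/
theorem jointLimit_rectSelfDual : ∀ u : ℕ → ℝ, Filter.Tendsto u Filter.atTop (nhdsWithin (0 : ℝ) (Set.Ioi 0)) → ∀ g : Literature.Probability.RandomPlanarGeometry.ConformalRectangle → ℝ, (∀ R : Literature.Probability.RandomPlanarGeometry.ConformalRectangle, Filter.Tendsto (fun n => Literature.Probability.Percolation.bondDomainCrossingProb R (u n)) Filter.atTop (nhds (g R))) → ∀ (w : ℝ) (hw : 0 < w) (L : Literature.Probability.RandomPlanarGeometry.ConformalRectangle), L.carrier = (Set.Ioo (0:ℝ) w ×ℂ Set.Ioo (0:ℝ) 1) → L.arc 0 = {z : ℂ | z.re = 0 ∧ z.im ∈ Set.Icc (0:ℝ) 1} → L.arc 2 = {z : ℂ | z.re = w ∧ z.im ∈ Set.Icc (0:ℝ) 1} → g L + g (Literature.Probability.Percolation.rectQuad 0 w 0 1 hw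 one_pos) = 1 :=
  fun _ hu _ hg _ hw L hLc hL0 hL2 => JointLimit.lr_add_bt_eq_one hu hg hw L hLc hL0 hL2

end Summit.CriticalPhenomena.CardyFormulaZ2.Cruxes.SubseqCardy.Birth

end
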